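import Summits.AtomisticToContinuum.FouriersLaw.Theses.HoelderEscapeProfile
import Summits.AtomisticToContinuum.FouriersLaw.Theorems.HoelderEscapeProfileFibreCalculus

/-!
# `CornerNoDip` (stmt-AtomisticToContinuum-16009), line `heatprofile`: stub `stub_profileRepresentation`

The EXCESS FORM OF THE FIBRE IDENTITIES for the Abel heating profile of the infinite pinned quartic
chain, in the crux's frame (`μ` a shift- and momentum-reversal-invariant Gibbs state of
`pinnedChain ω₂ lam β γ` at temperature `T`, `D` an infinite-volume dynamics preserving `μ` with
shift-covariant flow, `h` the split-bond site energy, `S x t = Cov_μ(h_0, h_x ∘ φ_t)`,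
`Sb ν x = ν ∫₀^∞ e^{-νt} S x t dt`, `G x t = ⟨j_0, j_x ∘ φ_t⟩_μ`,
`Gh ν k = ∫₀^∞ e^{-νt} Σ_x cos(kx) G x t dt`, both guards of the crux):

* static clustering `Σ_x (1 + x²)|S(x,0)| < ∞`, and for every `ν > 0`:
* `Σ_x (1 + x²)|S̄_ν(x)| < ∞`,
* the `k`-space conservation law in excess form
  `(2 − 2cos k)·Gh ν k = ν Σ_x (1 − cos kx)(S̄_ν(x) − S(x,0))` for every real `k`,
* Helfand–Abel at the fibre origin `Gh ν 0 = (ν/2) Σ_x x²(S̄_ν(x) − S(x,0))`.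

Proof.  All four are consequences of the route's crux `FibreCalculus`
(stmt-AtomisticToContinuum-16011), now PROVED
(`Theorems.FibreCalculusSketch.fibreCalculus_proof`): its conservation clause
`Σ_x S̄_ν(x) = χ(0) = Σ_x S(x,0)` turns the `k`-space conservation law
`χ(k) − f̂_ν(k) = (2 − 2cos k)·Gh ν k/ν` into the excess form, and Helfand–Abel
`∫₀^∞ e^{-νt} C_T = (ν/2)(Σ x² S̄_ν − Σ x² S(·,0))` together with `Gh ν 0 = ∫₀^∞ e^{-νt} C_T(t) dt`
(definitional: `C_T(t) = Σ_x G x t = D.currentCorrelation μ t`) gives the origin identity. The body is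
the implication `stub_profileRepresentation_of_fibreCalculus` of the registered skeleton
`Cruxes/CornerNoDip/Lines/heatprofile.lean`, applied to the landed theorem.
-/

noncomputable section

open Filter Topology Set MeasureTheory Finset

namespace Summit.AtomisticToContinuum.FouriersLaw.Theorems.CornerNoDip.HeatProfile

open Literature.MathematicalPhysics.KineticTheory.HeatConduction
open Summit.AtomisticToContinuum.FouriersLaw.Theses.HoelderEscapeProfile (FibreCalculus)

/-- **Stub `stub_profileRepresentation` of line `heatprofile` (crux `CornerNoDip`,
stmt-AtomisticToContinuum-16009)** — the excess form of the fibre identities. In the crux's frame: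
`Σ_x (1+x²)|S(x,0)| < ∞` and, for every `ν > 0`, `Σ_x (1+x²)|S̄_ν(x)| < ∞`,
`(2 − 2cos k)·Gh ν k = ν Σ_x (1 − cos kx)(S̄_ν(x) − S(x,0))` for every real `k`, and
`Gh ν 0 = (ν/2)Σ_x x²(S̄_ν(x) − S(x,0))`. From the proved route item `FibreCalculus`
(`FibreCalculusSketch.fibreCalculus_proof`): conservation turns the `k`-space conservation law into
the excess form; Helfand–Abel gives the origin identity.
[cite: Helfand1960] [cite: BonettoLebowitzReyBellet2000, §7 eq. (37)] -/
theorem stub_profileRepresentation :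
    ∀ ω₂ lam β γ : ℝ, 0 < ω₂ → 0 < lam → 0 < β → ∀ T : ℝ, 0 < T →
      ∀ μ : Measure ChainConfig, (pinnedChain ω₂ lam β γ).IsChainGibbsMeasure T μ → IsShiftInvariant μ →
        μ.map (fun σ : ChainConfig => fun x : ℤ => ((σ x).1, -(σ x).2)) = μ →
          ∀ D : InfiniteChainDynamics (pinnedChain ω₂ lam β γ), D.PreservesMeasure μ →
            (∀ t : ℝ, ∀ᵐ σ ∂μ, D.flow t (shift σ) = shift (D.flow t σ)) →
              ∀ h : ChainConfig → ℤ → ℝ, h = (fun (σ : ChainConfig) (x : ℤ) =>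
                  (σ x).2 ^ 2 / 2 + (pinnedChain ω₂ lam β γ).U (σ x).1 +
                    ((pinnedChain ω₂ lam β γ).V ((σ (x + 1)).1 - (σ x).1) +
                      (pinnedChain ω₂ lam β γ).V ((σ x).1 - (σ (x - 1)).1)) / 2) →
                ∀ S : ℤ → ℝ → ℝ, S = (fun (x : ℤ) (t : ℝ) =>
                    ∫ σ, (h σ 0 - ∫ σ', h σ' 0 ∂μ) * (h (D.flow t σ) x - ∫ σ', h σ' 0 ∂μ) ∂μ) →
                  ∀ Sb : ℝ → ℤ → ℝ, Sb = (fun (ν : ℝ) (x : ℤ) =>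
                      ν * ∫ t in Set.Ioi (0:ℝ), Real.exp (-(ν * t)) * S x t) →
                    ∀ G : ℤ → ℝ → ℝ, G = (fun (x : ℤ) (t : ℝ) =>
                        ∫ σ, (pinnedChain ω₂ lam β γ).bondCurrentZ σ 0 *
                          (pinnedChain ω₂ lam β γ).bondCurrentZ (D.flow t σ) x ∂μ) →
                      ∀ Gh : ℝ → ℝ → ℝ, Gh = (fun (ν k : ℝ) => ∫ t in Set.Ioi (0:ℝ),
                          Real.exp (-(ν * t)) * ∑' x : ℤ, Real.cos (k * (x : ℝ)) * G x t) →
                        (∀ t : ℝ, D.HasAbsConvergentCorrelation μ t) →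
                          (∀ ν : ℝ, 0 < ν → ∀ k : ℝ, IntegrableOn (fun t : ℝ =>
                              Real.exp (-(ν * t)) * ∑' x : ℤ, Real.cos (k * (x : ℝ)) * G x t) (Set.Ioi 0)) →
                            Summable (fun x : ℤ => (1 + (x : ℝ) ^ 2) * |S x 0|) ∧
                              ∀ ν : ℝ, 0 < ν →
                                Summable (fun x : ℤ => (1 + (x : ℝ) ^ 2) * |Sb ν x|) ∧
                                  (∀ k : ℝ, (2 - 2 * Real.cos k) * Gh ν k =
                                    ν * ∑' x : ℤ, (1 - Real.cos (k * (x : ℝ))) * (Sb ν x - S x 0)) ∧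
                                    Gh ν 0 = ν / 2 * ∑' x : ℤ, (x : ℝ) ^ 2 * (Sb ν x - S x 0) := by
  intro ω₂ lam β γ hω hl hβ T hT μ hGibbs hSI hRefl D hP hShift h hh S hS Sb hSb G hG Gh hGh _hAbs _hInt
  have hFC : FibreCalculus := FibreCalculusSketch.fibreCalculus_proof
  obtain ⟨-, -, -, hSumSb, hSumS0, -, hcons, -, -, -, hId, hHelf⟩ :=
    hFC ω₂ lam β γ hω hl hβ T hT μ hGibbs hSI hRefl D hP hShift h hh S hS Sb hSb G hG Gh hGh
      (fun (ν k : ℝ) => ∑' x : ℤ, Real.cos (k * (x : ℝ)) * Sb ν x) rfl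
      (fun k : ℝ => ∑' x : ℤ, Real.cos (k * (x : ℝ)) * S x 0) rfl
  -- summability bookkeeping
  have hdomS0 : ∀ {g : ℤ → ℝ}, (∀ x, |g x| ≤ (1 + (x : ℝ) ^ 2) * |S x 0|) → Summable g :=
    fun hg => Summable.of_norm_bounded hSumS0 (fun x => by simpa only [Real.norm_eq_abs] using hg x)
  have h1le : ∀ x : ℤ, (1 : ℝ) ≤ 1 + (x : ℝ) ^ 2 := fun x => by nlinarith [sq_nonneg (x : ℝ)]
  have hx2le : ∀ x : ℤ, (x : ℝ) ^ 2 ≤ 1 + (x : ℝ) ^ 2 := fun x => by linarith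
  have hcosle : ∀ (k : ℝ) (x : ℤ) (u : ℝ), |Real.cos (k * (x : ℝ)) * u| ≤ (1 + (x : ℝ) ^ 2) * |u| := by
    intro k x u
    rw [abs_mul]
    exact mul_le_mul ((Real.abs_cos_le_one _).trans (h1le x)) le_rfl (abs_nonneg _) (by positivity)
  have hsS0c : ∀ k : ℝ, Summable fun x : ℤ => Real.cos (k * (x : ℝ)) * S x 0 :=
    fun k => hdomS0 fun x => hcosle k x (S x 0)
  have hsS0 : Summable fun x : ℤ => S x 0 := hdomS0 fun x => by
    simpa using mul_le_mul_of_nonneg_right (h1le x) (abs_nonneg (S x 0))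
  have hsS02 : Summable fun x : ℤ => (x : ℝ) ^ 2 * S x 0 := hdomS0 fun x => by
    rw [abs_mul, abs_of_nonneg (sq_nonneg _)]
    exact mul_le_mul_of_nonneg_right (hx2le x) (abs_nonneg _)
  refine ⟨hSumS0, fun ν hν => ?_⟩
  have hSb := hSumSb ν hν
  have hdomSb : ∀ {g : ℤ → ℝ}, (∀ x, |g x| ≤ (1 + (x : ℝ) ^ 2) * |Sb ν x|) → Summable g :=
    fun hg => Summable.of_norm_bounded hSb (fun x => by simpa only [Real.norm_eq_abs] using hg x)
  have hsSbc : ∀ k : ℝ, Summable fun x : ℤ => Real.cos (k * (x : ℝ)) * Sb ν x :=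
    fun k => hdomSb fun x => hcosle k x (Sb ν x)
  have hsSb : Summable fun x : ℤ => Sb ν x := hdomSb fun x => by
    simpa using mul_le_mul_of_nonneg_right (h1le x) (abs_nonneg (Sb ν x))
  have hsSb2 : Summable fun x : ℤ => (x : ℝ) ^ 2 * Sb ν x := hdomSb fun x => by
    rw [abs_mul, abs_of_nonneg (sq_nonneg _)]
    exact mul_le_mul_of_nonneg_right (hx2le x) (abs_nonneg _)
  -- conservation: Σ Sb ν = Σ S(·,0)
  have hcons' : ∑' x : ℤ, Sb ν x = ∑' x : ℤ, S x 0 := by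
    have := hcons ν hν
    simpa only [zero_mul, Real.cos_zero, one_mul] using this
  refine ⟨hSb, fun k => ?_, ?_⟩
  · -- excess form of the k-space conservation law
    have hid : (∑' x : ℤ, Real.cos (k * (x : ℝ)) * S x 0) - (∑' x : ℤ, Real.cos (k * (x : ℝ)) * Sb ν x) =
        (2 - 2 * Real.cos k) * Gh ν k / ν := hId ν hν k
    have e1 : (2 - 2 * Real.cos k) * Gh ν k =
        ν * ((∑' x : ℤ, Real.cos (k * (x : ℝ)) * S x 0) - ∑' x : ℤ, Real.cos (k * (x : ℝ)) * Sb ν x) := by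
      rw [hid]; field_simp
    have e2 : (fun x : ℤ => (1 - Real.cos (k * (x : ℝ))) * (Sb ν x - S x 0)) =
        fun x : ℤ => (Sb ν x - S x 0) - (Real.cos (k * (x : ℝ)) * Sb ν x - Real.cos (k * (x : ℝ)) * S x 0) := by
      funext x; ring
    rw [e1, e2, Summable.tsum_sub (hsSb.sub hsS0) ((hsSbc k).sub (hsS0c k)), Summable.tsum_sub hsSb hsS0,
      Summable.tsum_sub (hsSbc k) (hsS0c k), hcons']
    ring
  · -- Helfand–Abel at the fibre origin
    have hGh0 : Gh ν 0 = ∫ t in Set.Ioi (0:ℝ), Real.exp (-(ν * t)) * D.currentCorrelation μ t := by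
      rw [hGh, hG]
      simp only [zero_mul, Real.cos_zero, one_mul]
      rfl
    rw [hGh0, hHelf ν hν, ← Summable.tsum_sub hsSb2 hsS02]
    congr 1
    exact tsum_congr fun x => by ring

end Summit.AtomisticToContinuum.FouriersLaw.Theorems.CornerNoDip.HeatProfile

end
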